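import Literature.MathematicalPhysics.QuantumFieldTheory.Balaban1983to89.B9CubeLettersInvReadDictB

/-!
# `Balaban1983to89.B9CubeLettersInvWriteDictB` — T. Bałaban, *Propagators for lattice gauge theories in a background field*, Commun. Math. Phys.
# **99** (1985) 389–434 [Balaban1985BackgroundPropagators], Thm 3.3 p. 399 with (3.42) p. 397 WRITTEN over the gauge-invariant test class, BOND SECTOR,
# from the [4]-(2.51) block majorants of the real-coordinate letters (same configuration) — the bond-sector twin of p21's `B9CubeLettersInvWriteDict`
# (sub-row G-B9-LETTERS, DictB-WRITE)

statement-level skeleton of published theorems with citation tags; proofs where landed; nothing here is a claim about the Yang–Mills mass gap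

PDF held: `paper:balaban1985-cmp99-background-propagators` (journal page = PDF page + 388); pp. 397, 399 read from the held text layer; [4] =
[Balaban1984PropagatorsII] (2.51) p. 232.

THE PRINT.  p. 399, Theorem 3.3: «the operator G(U) (a = 1) satisfies the inequalities (3.42)–(3.47), with G′(U) replaced by G(U) and λ replaced by a
function J defined at bonds of the lattice T_η, or Ω₀, and with values in g»; p. 397 (3.42): «|(G′(U)λ)(x)|, |(∇_UG′(U)λ)(x)|, |(G′(U)∇*_Uλ)(x)|,
|(Δ_UG′(U)λ)(x)| ≤ B₀[(Lʲη)², Lʲη, Lʲη, 1]e^{−δ₀d(y,y′)}|λ| for x∈Δ(y), y∈Λ_j, supp λ ⊂ Δ(y′)»; [4] p. 232 (2.51): «|(Rλ)(x)| ≦ O(M⁻¹)e^{−δ₀d(x,y)}|λ|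
if supp λ ⊂ Bʲ(y), y ∈ Λ_j.», followed by «Let us consider n operators R₁, R₂, …, R_n satisfying (2.51) with a constant O(1) instead of O(M⁻¹)»
(the majorant shape `|(Tλ)(x)| ≤ K(y,y′)|λ|` that `B6RandomWalk.HasMajorant` formalises).

WHY THIS FILE (cell context: G-B9-LETTERS; the WRITE half of the bond-sector dictionary whose READ half is `B9CubeLettersInvReadDictB`; consumer: whichever
module must PRODUCE the Thm-3.3 block `B9FromB6.EBlock (kernelFamilyBInv i B cfg O par) B₀ δ U₁` of a bond cube letter `G_□(U)` (r05's
`B9CubeLettersBondOpsL0`) from the outputs of the Sect.-B machinery, which are block majorants of real-coordinate letters).  p21's site-sector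
`eBlock_kernelFamilySInv_of_hasMajorant` writes the (3.42) block over the class from the four majorant families of the conj-`b` letters; this file does the
same on the fine-bond carrier `FBondY i` with block map `(x, j) ↦ ιB(Δ(x))` (`Δ(x) = blkV1 x`): the coordinates of ANY `Λ ∈ TestY 𝔸 J` are supported in the
block of `supp J` and bounded by `M₂|J|` (`norm_apply_le_of_hasMajorant_testYB`, [4] (2.51) through coordinates), so block majorants
`B_c·ℓ(a)^{(2,1,1,0)}·e^{−δd(a,a′)}` of `conj b G`, `conj b D_ν * conj b G`, `conj b G * conj b D*_ν`, `conj b L * conj b G` — `G`, `D_ν`, `D*_ν`, `L` ANY ℝ-linear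
maps agreeing pointwise with `O(cfg U₁)`, `∇_{U,ν}` (`cdB`), `∇*_{U,ν}` (`cdsB`), `Δ_U` (`lapB`) of def-Y (no units: the bond-sector family carries `c_f` inside
the covariant differences) — give `EBlock (kernelFamilyBInv i B cfg O par) (M₂(Σ_j‖b_j‖)·B_c) δ U₁`, SAME rate.  With `B9CubeLettersInvReadDictB` and E′₃'s
`hasMajorant_conj_of_ball_boundB` the block over the class and the block majorants are equivalent up to the basis constant — «of course with different
constants» (p. 403).  Corner-free members only (a section `ιB` of `β`).

WHAT IS PROVED (all `theorem`s, 0 `def … : Prop`, 0 sorry).  ★ `norm_apply_le_of_hasMajorant_testYB`; ★★ `eBlock_kernelFamilyBInv_of_hasMajorant`.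
HONEST SCOPE.  Bookkeeping only: nothing of Thm 3.3 is asserted (the majorants are HYPOTHESES); nothing continuum ∕ OS ∕ mass gap ∕ Clay; YM mass gap NOT
proved by any of this (Track A conditional rung).  `--supports stmt-QuantumFields-19200`.  Net new unproved facts: 0.
-/

noncomputable section

namespace Literature.MathematicalPhysics.QuantumFieldTheory.Balaban1983to89.B9CubeLettersInvWriteDictB

open Node00 B9CubeLettersInvReadings
open B9CubeLettersInvReadDict (iSup_testY_le)
open B9CubeLettersInvReadDictB (supInB_le)
open Node00.OpsYRead342 (geo9K_len_congr geo9K_dist_congr)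
open B6GlobalChartV1 (blkV1)
open B6Ineq2142KLevelV1 (β)
open B6KLevelCensusIndexV1 (KIdx)
open B6RandomWalk (HasMajorant BlockSupp)
open B9Thm34Ext (toB6)
open B9FromB6 (EBlock)
open B9GeoNormsKLevelV1 (geo9K geo9K_supNorm_nonneg)
open B9Eq352DivFormLetters (coordEquiv conj conj_apply coordEquiv_apply)
open B9Ineq347AllEntries (pref4_nonneg)
open B9CoReadingCoords (norm_le_basisBound_mul)
open scoped Matrix

variable {d ℓ : ℕ} {hd : 1 ≤ d + 1} {hL : Odd (ℓ + 1) ∧ 1 < ℓ + 1} {b₀ b₁ : ℝ}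
variable {𝔸 : Type} [NormedRing 𝔸] [NormedAlgebra ℂ 𝔸] [CompleteSpace 𝔸]
variable {ι : Type} [Fintype ι]
variable (i : KIdx d ℓ hd hL b₀ b₁) (b : Module.Basis ι ℝ 𝔸)

section Write

variable {B : B9.Backgrounds} (cfg : B.Cfg → CfgY 𝔸 i) (O : BondOpY 𝔸 i) (par : BondParY 𝔸 i) {U₁ : B.Cfg}
variable [Fintype (geo9K i).Site] {Rr : ℝ} {Hp : Prop}

omit [NormedRing 𝔸] [NormedAlgebra ℂ 𝔸] [CompleteSpace 𝔸] [Fintype ι] [Fintype (geo9K i).Site] in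
/-- the (2.67)∕(3.42) length of a carrier index is non-negative. [cite: Balaban1985BackgroundPropagators, (3.41) p.397, bookkeeping] -/
private theorem geo9K_len_nonneg (c : IBondY i) : 0 ≤ (geo9K i).len c := (B6KLevelCensusIndexV1.len_pos i c).le

omit [NormedRing 𝔸] [NormedAlgebra ℂ 𝔸] [CompleteSpace 𝔸] [Fintype ι] [Fintype (geo9K i).Site] in
/-- `|J(x)| ≤ |J|` for a bond profile (the sup norm of the bond sector dominates every value). [cite: Balaban1985BackgroundPropagators, (3.39) p.397, bookkeeping] -/
private theorem abs_le_supNorm_inr' (J : FBondY i → ℝ) (x : FBondY i) : |J x| ≤ (geo9K i).supNorm (Sum.inr J) :=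
  le_ciSup (f := fun x => |J x|) (Set.finite_range _).bddAbove x

omit [CompleteSpace 𝔸] in
/-- ★ **THE (2.51) WRITING THROUGH COORDINATES ON THE BOND CARRIER, FOR EVERY TEST FUNCTION OF THE CLASS**: a block majorant `K` of `conj b T` w.r.t.
`(x, j) ↦ ιB(Δ(x))` bounds `‖(TΛ)(x)‖` for every `Λ` with `‖Λ(w)‖ ≤ |J(w)|`, `supp J ⊂ Δ(βy′)`, by `(Σ_j‖b_j‖)·K(ιB(Δ(x)), ιB(βy′))·M₂|J|` (the coordinates of
`Λ` are supported in the block of `ιB(βy′)` and bounded by `M₂|J|`). [cite: Balaban1984PropagatorsII, (2.51) p.232 (the majorant shape |(Tλ)(x)| ≤ K(y,y′)|λ|); Balaban1985BackgroundPropagators, Thm 3.3 p.399 with (3.39) + (3.42) p.397] -/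
theorem norm_apply_le_of_hasMajorant_testYB (T : Module.End ℝ (FBondY i → 𝔸)) (ιB : BlkY i → IBondY i)
    {M₂ : ℝ} (hM₂ : 0 ≤ M₂) (hrepr : ∀ (v : 𝔸) (j : ι), |b.repr v j| ≤ M₂ * ‖v‖) {Kmaj : IBondY i → IBondY i → ℝ}
    (h : HasMajorant (g := toB6 (geo9K i) Rr Hp) (fun p : FBondY i × ι => ιB (blkV1 i.hN i.D p.1)) (conj b T) Kmaj)
    (J : FBondY i → ℝ) (y' : IBondY i) (hs : (geo9K i).suppIn (Sum.inr J) y') (Λ : TestY 𝔸 J) (x : FBondY i) :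
    ‖T Λ.1 x‖ ≤ (∑ j, ‖b j‖) * (Kmaj (ιB (blkV1 i.hN i.D x)) (ιB (β i.hN i.D i.hk y')) * (M₂ * (geo9K i).supNorm (Sum.inr J))) := by
  have hN0 : 0 ≤ (geo9K i).supNorm (Sum.inr J) := geo9K_supNorm_nonneg i _
  have hBS : BlockSupp (g := toB6 (geo9K i) Rr Hp) (fun p : FBondY i × ι => ιB (blkV1 i.hN i.D p.1)) (coordEquiv b Λ.1)
      (ιB (β i.hN i.D i.hk y')) (M₂ * (geo9K i).supNorm (Sum.inr J)) := by
    refine ⟨mul_nonneg hM₂ hN0, fun p _ => ?_, fun p hp => ?_⟩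
    · rw [coordEquiv_apply]
      calc |b.repr (Λ.1 p.1) p.2| ≤ M₂ * ‖Λ.1 p.1‖ := hrepr _ _
        _ ≤ M₂ * (geo9K i).supNorm (Sum.inr J) :=
            mul_le_mul_of_nonneg_left ((Λ.2 p.1).trans (abs_le_supNorm_inr' i J p.1)) hM₂
    · have hJ : J p.1 = 0 := by
        by_contra hJ
        exact hp (congrArg ιB (hs p.1 hJ))
      have hΛ : Λ.1 p.1 = 0 := by
        have h0 : ‖Λ.1 p.1‖ ≤ 0 := by simpa only [hJ, abs_zero] using Λ.2 p.1
        exact norm_le_zero_iff.1 h0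
      rw [coordEquiv_apply, hΛ, map_zero, Finsupp.zero_apply]
  have hco : ∀ j : ι, |b.repr (T Λ.1 x) j| ≤
      Kmaj (ιB (blkV1 i.hN i.D x)) (ιB (β i.hN i.D i.hk y')) * (M₂ * (geo9K i).supNorm (Sum.inr J)) := by
    intro j
    have h1 := h _ _ _ hBS (x, j)
    simpa only [conj_apply, LinearEquiv.symm_apply_apply] using h1
  exact norm_le_basisBound_mul b _ hco

/-- ★★ **WRITE AT ONE CONFIGURATION, OVER THE CLASS, BOND SECTOR**: block majorants `B_c·ℓ(a)^{(2,1,1,0)}·e^{−δd(a,a′)}` of the four conjugated bond letters at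
`cfg U₁` — `conj b G`, `conj b D_ν * conj b G` (every `ν`), `conj b G * conj b D*_ν` (every `ν`), `conj b L * conj b G` — for ANY ℝ-linear `G`, `D_ν`, `D*_ν`,
`L` agreeing pointwise with `O(cfg U₁)`, `∇_{U,ν}`, `∇*_{U,ν}`, `Δ_U` of def-Y's bond sector, give the (3.42) block of the reading `kernelFamilyBInv i B cfg O par`
OVER THE INVARIANT CLASS at `U₁` with constant `M₂(Σ_j‖b_j‖)·B_c` and the SAME rate `δ`.
[cite: Balaban1985BackgroundPropagators, Thm 3.3 p.399 with (3.42) p.397, (3.39) p.397 (sup over all λ); Balaban1984PropagatorsII, (2.51)–(2.52) p.232] -/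
theorem eBlock_kernelFamilyBInv_of_hasMajorant (ιB : BlkY i → IBondY i) (hι : ∀ s, β i.hN i.D i.hk (ιB s) = s)
    {M₂ : ℝ} (hM₂ : 0 ≤ M₂) (hrepr : ∀ (v : 𝔸) (j : ι), |b.repr v j| ≤ M₂ * ‖v‖)
    (G : Module.End ℝ (FBondY i → 𝔸)) (hG : ∀ Λ, G Λ = O (cfg U₁) Λ)
    (D Ds : Fin (d + 1) → Module.End ℝ (FBondY i → 𝔸)) (hD : ∀ ν Λ, D ν Λ = cdB i (cfg U₁) ν Λ) (hDs : ∀ ν Λ, Ds ν Λ = cdsB i (cfg U₁) ν Λ)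
    (L : Module.End ℝ (FBondY i → 𝔸)) (hL : ∀ Λ, L Λ = lapB i (cfg U₁) Λ)
    {Bc δ : ℝ} (hBc : 0 ≤ Bc)
    (h0 : HasMajorant (g := toB6 (geo9K i) Rr Hp) (fun p : FBondY i × ι => ιB (blkV1 i.hN i.D p.1)) (conj b G)
      (fun a a' => Bc * (geo9K i).len a ^ 2 * Real.exp (-(δ * (geo9K i).dist a a'))))
    (h1 : ∀ ν : Fin (d + 1), HasMajorant (g := toB6 (geo9K i) Rr Hp) (fun p : FBondY i × ι => ιB (blkV1 i.hN i.D p.1)) (conj b (D ν) * conj b G)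
      (fun a a' => Bc * (geo9K i).len a * Real.exp (-(δ * (geo9K i).dist a a'))))
    (h2 : ∀ ν : Fin (d + 1), HasMajorant (g := toB6 (geo9K i) Rr Hp) (fun p : FBondY i × ι => ιB (blkV1 i.hN i.D p.1)) (conj b G * conj b (Ds ν))
      (fun a a' => Bc * (geo9K i).len a * Real.exp (-(δ * (geo9K i).dist a a'))))
    (h3 : HasMajorant (g := toB6 (geo9K i) Rr Hp) (fun p : FBondY i × ι => ιB (blkV1 i.hN i.D p.1)) (conj b L * conj b G)
      (fun a a' => Bc * 1 * Real.exp (-(δ * (geo9K i).dist a a')))) :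
    EBlock (kernelFamilyBInv i B cfg O par) (M₂ * (∑ j, ‖b j‖) * Bc) δ U₁ := by
  have hSb : 0 ≤ ∑ j, ‖b j‖ := Finset.sum_nonneg fun _ _ => norm_nonneg _
  have hC : 0 ≤ M₂ * (∑ j, ‖b j‖) * Bc := mul_nonneg (mul_nonneg hM₂ hSb) hBc
  intro n lam y y' hs
  have hRHS : 0 ≤ M₂ * (∑ j, ‖b j‖) * Bc * B9.pref4 ((geo9K i).len y) n * Real.exp (-(δ * (geo9K i).dist y y')) * (geo9K i).supNorm lam :=
    mul_nonneg (mul_nonneg (mul_nonneg hC (pref4_nonneg _ (geo9K_len_nonneg i y) n)) (Real.exp_pos _).le) (geo9K_supNorm_nonneg i lam)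
  cases lam with
  | inl f => exact hRHS
  | inr J =>
    have hR : ∀ {P : ℝ}, 0 ≤ P →
        0 ≤ M₂ * (∑ j, ‖b j‖) * Bc * P * Real.exp (-(δ * (geo9K i).dist y y')) * (geo9K i).supNorm (Sum.inr J) := fun hP =>
      mul_nonneg (mul_nonneg (mul_nonneg hC hP) (Real.exp_pos _).le) (geo9K_supNorm_nonneg i _)
    have hlen : ∀ x : FBondY i, blkV1 i.hN i.D x = β i.hN i.D i.hk y → (geo9K i).len (ιB (blkV1 i.hN i.D x)) = (geo9K i).len y :=
      fun x hx => geo9K_len_congr i (by rw [hι]; exact hx)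
    have hdist : ∀ x : FBondY i, blkV1 i.hN i.D x = β i.hN i.D i.hk y →
        (geo9K i).dist (ιB (blkV1 i.hN i.D x)) (ιB (β i.hN i.D i.hk y')) = (geo9K i).dist y y' :=
      fun x hx => geo9K_dist_congr i (by rw [hι]; exact hx) (hι _)
    fin_cases n
    · -- (3.42)₁: sup_Λ sup_{x ∈ Δ(y)} ‖(OΛ)(x)‖
      show (⨆ Λ : TestY 𝔸 J, supInB i (β i.hN i.D i.hk y) (O (cfg U₁) Λ.1)) ≤
        M₂ * (∑ j, ‖b j‖) * Bc * ((geo9K i).len y ^ 2) * Real.exp (-(δ * (geo9K i).dist y y')) * (geo9K i).supNorm (Sum.inr J)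
      refine iSup_testY_le (fun Λ => ?_) (hR (sq_nonneg _))
      refine supInB_le i _ _ (hR (sq_nonneg _)) fun x hx => ?_
      have hw := norm_apply_le_of_hasMajorant_testYB i b (Rr := Rr) (Hp := Hp) G ιB hM₂ hrepr h0 J y' hs Λ x
      rw [hG, hlen x hx, hdist x hx] at hw
      exact hw.trans (le_of_eq (by ring))
    · -- (3.42)₂: sup_Λ max_ν sup_{x ∈ Δ(y)} ‖(∇_{U,ν}OΛ)(x)‖
      show (⨆ Λ : TestY 𝔸 J, ⨆ ν : Fin (d + 1), supInB i (β i.hN i.D i.hk y) (cdB i (cfg U₁) ν (O (cfg U₁) Λ.1))) ≤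
        M₂ * (∑ j, ‖b j‖) * Bc * (geo9K i).len y * Real.exp (-(δ * (geo9K i).dist y y')) * (geo9K i).supNorm (Sum.inr J)
      refine iSup_testY_le (fun Λ => ?_) (hR (geo9K_len_nonneg i y))
      refine Real.iSup_le (fun ν => ?_) (hR (geo9K_len_nonneg i y))
      refine supInB_le i _ _ (hR (geo9K_len_nonneg i y)) fun x hx => ?_
      have h1' := h1 ν
      rw [← B9Eq352DivFormLetters.conj_mul] at h1'
      have hw := norm_apply_le_of_hasMajorant_testYB i b (Rr := Rr) (Hp := Hp) _ ιB hM₂ hrepr h1' J y' hs Λ x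
      rw [Module.End.mul_apply, hD, hG, hlen x hx, hdist x hx] at hw
      exact hw.trans (le_of_eq (by ring))
    · -- (3.42)₃: sup_Λ max_ν sup_{x ∈ Δ(y)} ‖(O∇*_{U,ν}Λ)(x)‖
      show (⨆ Λ : TestY 𝔸 J, ⨆ ν : Fin (d + 1), supInB i (β i.hN i.D i.hk y) (O (cfg U₁) (cdsB i (cfg U₁) ν Λ.1))) ≤
        M₂ * (∑ j, ‖b j‖) * Bc * (geo9K i).len y * Real.exp (-(δ * (geo9K i).dist y y')) * (geo9K i).supNorm (Sum.inr J)
      refine iSup_testY_le (fun Λ => ?_) (hR (geo9K_len_nonneg i y))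
      refine Real.iSup_le (fun ν => ?_) (hR (geo9K_len_nonneg i y))
      refine supInB_le i _ _ (hR (geo9K_len_nonneg i y)) fun x hx => ?_
      have h2' := h2 ν
      rw [← B9Eq352DivFormLetters.conj_mul] at h2'
      have hw := norm_apply_le_of_hasMajorant_testYB i b (Rr := Rr) (Hp := Hp) _ ιB hM₂ hrepr h2' J y' hs Λ x
      rw [Module.End.mul_apply, hDs, hG, hlen x hx, hdist x hx] at hw
      exact hw.trans (le_of_eq (by ring))
    · -- (3.42)₄: sup_Λ sup_{x ∈ Δ(y)} ‖(Δ_U OΛ)(x)‖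
      show (⨆ Λ : TestY 𝔸 J, supInB i (β i.hN i.D i.hk y) (lapB i (cfg U₁) (O (cfg U₁) Λ.1))) ≤
        M₂ * (∑ j, ‖b j‖) * Bc * 1 * Real.exp (-(δ * (geo9K i).dist y y')) * (geo9K i).supNorm (Sum.inr J)
      refine iSup_testY_le (fun Λ => ?_) (hR zero_le_one)
      refine supInB_le i _ _ (hR zero_le_one) fun x hx => ?_
      have h3' := h3
      rw [← B9Eq352DivFormLetters.conj_mul] at h3'
      have hw := norm_apply_le_of_hasMajorant_testYB i b (Rr := Rr) (Hp := Hp) _ ιB hM₂ hrepr h3' J y' hs Λ x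
      rw [Module.End.mul_apply, hL, hG, hdist x hx] at hw
      exact hw.trans (le_of_eq (by ring))

end Write

end Literature.MathematicalPhysics.QuantumFieldTheory.Balaban1983to89.B9CubeLettersInvWriteDictB

end
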